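import Summits.ABC.ABC.Theorems.FeketeScalesAssembly
import Summits.ABC.ABC.Theorems.FeketeScalesTargetEffectiveDuality

/-!
# Route FeketeScales — crux `Target` (stmt-ABC-2159): the Fekete upgrade with explicit constants

Second of three files on the EFFECTIVE form of the thesis (`--supports stmt-ABC-2159`, closes
nothing).  `TargetEff.logBound_core`: if abc triples are sub-multiplicative across radical scales
`≥ R₀` with slack `e^L e^{(log R₁R₂)^θ}` (`0 ≤ θ < 1`) and every window `[N, N²]`,
`N ≥ exp(C δ^{-B})`, contains a `δ`-good scale (effective SPARSE good scales — on its own this gives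
only `c ≪_δ rad^{2+2δ}`), then `log c ≤ (1+3δ) log rad + A δ^{-k}` for all `0 < δ ≤ 1` and all abc
triples, with
`k, A` depending on `θ, L, B, C, R₀` only.  This is the route's Assembly
(`FeketeScalesAssembly.allScales`, the finitary Fekete lemma with a sub-power error term) run from
a good scale `R ∈ [N₀, N₀²]`, `N₀ = ⌈exp t₀⌉`, `t₀ = max(T, C δ^{-B}, log R₀)`, with every threshold and
sublinearity intercept written as a power of `1/δ` (`TargetEff.rpow_le_linear_add_rpow`).
Consequence (third file, `FeketeScalesTargetEffective.lean`): scale sub-multiplicativity plus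
effective sparse good scales is EXACTLY the pointwise sub-power slack (whereas effective good scales at
ALL large scales is the sub-power slack by itself, trivially).  The registered calibration sub-goal
`calib_logBound_of_submult_of_effectiveGoodScales` (all-scales form) is the special case `R = N`.

Elementary real analysis; Mathlib only; no new definitions.
-/

-- `Summit.<Summit>.<Problem>` is the mandated summit-side namespace (CONVENTIONS §2); for the
-- single-conjunct summit `ABC` the two coincide, so the duplicate `ABC.ABC` is deliberate.
set_option linter.dupNamespace false

namespace Summit.ABC.ABC.Theorems

open Literature.NumberTheory.DiophantineGeometry
open Summit.ABC.ABC.Theses.FeketeScales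

set_option maxHeartbeats 400000 in
/-- **Effective Fekete upgrade (normalised data).**  If abc triples are sub-multiplicative across
radical scales `≥ R₀ ≥ 2` with slack `e^L e^{(log R₁R₂)^θ}` (`0 ≤ θ < 1`, `0 ≤ L`), and every scale
window `[N, N²]` with `N ≥ exp(C δ^{-B})` contains a `δ`-good scale (`B, C ≥ 1`; "effective SPARSE
good scales"), then for all `0 < δ ≤ 1` and all abc triples
`log c ≤ (1 + 3δ) log rad + A δ^{-k}` with `k, A` depending only on `θ, L, B, C, R₀`.
Proof: the Assembly's iteration `FeketeScalesAssembly.allScales` from a good scale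
`R ∈ [N₀, N₀²]`, `N₀ = ⌈exp t₀⌉`, `t₀ = max(T, C δ^{-B}, log R₀)` where `T = 2(L + 2^θ B₁)/(δ(2-2^θ))` and
`B₁ = (δ(2-2^θ)/(2·2^θ))^{-θ/(1-θ)}` is the explicit sublinearity intercept
(`TargetEff.rpow_le_linear_add_rpow`); every threshold and intercept is a power of `1/δ`, whence
the final intercept `(1+3δ) log R + γ (γ/(δ log R))^{φ/(1-φ)} ≤ 5 (4 c₃ C₅)^{1+p} δ^{-E(1+p)}`
(`φ = (1+θ)/2`, `p = φ/(1-φ)`, `E = max(1 + θ/(1-θ), B)`). [folklore] -/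
theorem TargetEff.logBound_core {θ L B C : ℝ} {R₀ : ℕ} (hθ0 : 0 ≤ θ) (hθ1 : θ < 1) (hL : 0 ≤ L)
    (hB1 : 1 ≤ B) (hC1 : 1 ≤ C) (hR₀ : 2 ≤ R₀)
    (hsub : ∀ R₁ R₂ : ℕ, R₀ ≤ R₁ → R₀ ≤ R₂ → ∀ a b c : ℕ, IsABCTriple a b c → rad a b c ≤ R₁ * R₂ →
      ∃ a₁ b₁ c₁ a₂ b₂ c₂ : ℕ, IsABCTriple a₁ b₁ c₁ ∧ rad a₁ b₁ c₁ ≤ R₁ ∧ IsABCTriple a₂ b₂ c₂ ∧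
        rad a₂ b₂ c₂ ≤ R₂ ∧
        (c : ℝ) ≤ Real.exp L * Real.exp (Real.log ((R₁ : ℝ) * R₂) ^ θ) * c₁ * c₂)
    (hgood : ∀ δ : ℝ, 0 < δ → δ ≤ 1 → ∀ N : ℕ, Real.exp (C * δ ^ (-B)) ≤ (N : ℝ) →
      ∃ R : ℕ, N ≤ R ∧ R ≤ N ^ 2 ∧
        ∀ a b c : ℕ, IsABCTriple a b c → rad a b c ≤ R → (c : ℝ) ≤ (R : ℝ) ^ (1 + δ)) :
    ∃ k A : ℝ, 0 ≤ k ∧ ∀ δ : ℝ, 0 < δ → δ ≤ 1 → ∀ a b c : ℕ, IsABCTriple a b c →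
      Real.log (c : ℝ) ≤ (1 + 3 * δ) * Real.log ((rad a b c : ℕ) : ℝ) + A * δ ^ (-k) := by
  -- constants attached to `θ`
  have h2θ : (2:ℝ) ^ θ < 2 := by
    have := Real.rpow_lt_rpow_of_exponent_lt (by norm_num : (1:ℝ) < 2) hθ1
    rwa [Real.rpow_one] at this
  have h2θ1 : 1 ≤ (2:ℝ) ^ θ := Real.one_le_rpow (by norm_num) hθ0
  have h2θpos : 0 < (2:ℝ) ^ θ := by positivity
  have hcθ : 0 < 2 - (2:ℝ) ^ θ := by linarith
  set q : ℝ := θ / (1 - θ) with hq_def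
  have hq0 : 0 ≤ q := by rw [hq_def]; exact div_nonneg hθ0 (by linarith)
  clear_value q
  set φ : ℝ := (1 + θ) / 2 with hφ
  have hθφ : θ ≤ φ := by rw [hφ]; linarith
  have hφ0 : 0 < φ := by rw [hφ]; linarith
  have hφ1 : φ < 1 := by rw [hφ]; linarith
  have hφhalf : 1 / 2 ≤ φ := by rw [hφ]; linarith
  clear_value φ
  have h2φ : (2:ℝ) ^ (-φ) < 1 := Real.rpow_lt_one_of_one_lt_of_neg (by norm_num) (by linarith)
  have h2φ0 : 0 < (2:ℝ) ^ (-φ) := by positivity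
  have h2φ' : 0 < 1 - (2:ℝ) ^ (-φ) := by linarith
  set p : ℝ := φ / (1 - φ) with hp_def
  have hp1 : 1 ≤ p := by
    rw [hp_def, le_div_iff₀ (by linarith)]; linarith
  have hp0 : 0 ≤ p := zero_le_one.trans hp1
  clear_value p
  -- `m = (2 - 2^θ)/(2·2^θ)` and the `δ`-free part of the sublinearity intercept
  set m : ℝ := (2 - (2:ℝ) ^ θ) / (2 * (2:ℝ) ^ θ) with hm_def
  have hm0 : 0 < m := by rw [hm_def]; exact div_pos hcθ (by positivity)
  clear_value m
  set m' : ℝ := m ^ (-q) with hm'_def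
  have hm'0 : 0 ≤ m' := by rw [hm'_def]; exact Real.rpow_nonneg hm0.le _
  clear_value m'
  set CT : ℝ := 2 / (2 - (2:ℝ) ^ θ) * (L + (2:ℝ) ^ θ * m') with hCT_def
  have hCT0 : 0 ≤ CT := by
    rw [hCT_def]; exact mul_nonneg (div_nonneg (by norm_num) hcθ.le) (by positivity)
  clear_value CT
  have hlogR₀ : 0 ≤ Real.log R₀ := Real.log_nonneg (by exact_mod_cast (by omega : 1 ≤ R₀))
  set C₅ : ℝ := CT + C + Real.log R₀ with hC₅_def
  have hC₅1 : 1 ≤ C₅ := by rw [hC₅_def]; linarith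
  clear_value C₅
  set c₃ : ℝ := (L + 1) / (1 - (2:ℝ) ^ (-φ)) with hc₃_def
  have hc₃1 : 1 ≤ c₃ := by
    rw [hc₃_def, le_div_iff₀ h2φ']
    linarith
  have hc₃0 : 0 < c₃ := by linarith
  set E : ℝ := max (1 + q) B with hE_def
  have hE1q : 1 + q ≤ E := by rw [hE_def]; exact le_max_left _ _
  have hEB : B ≤ E := by rw [hE_def]; exact le_max_right _ _
  clear_value E
  have hE1 : 1 ≤ E := le_trans (by linarith) hE1q
  have hE0 : 0 ≤ E := zero_le_one.trans hE1
  refine ⟨E * (1 + p), 5 * (4 * c₃ * C₅) ^ (1 + p), by positivity, ?_⟩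
  intro δ hδ hδ1 a b c habc
  -- negative powers of `δ`
  have hδE1 : 1 ≤ δ ^ (-E) := TargetEff.one_le_rpow_neg hδ hδ1 hE0
  have hδE0 : 0 < δ ^ (-E) := by positivity
  -- Step 1: the threshold `T` with `L + 2^θ t^θ ≤ δ (2 - 2^θ) t` for `t ≥ T`
  set κ₁ : ℝ := δ * (2 - (2:ℝ) ^ θ) with hκ₁
  have hκ₁0 : 0 < κ₁ := by rw [hκ₁]; exact mul_pos hδ hcθ
  have ha₁ : 0 < κ₁ / (2 * (2:ℝ) ^ θ) := by positivity
  set B₁ : ℝ := (κ₁ / (2 * (2:ℝ) ^ θ)) ^ (-q) with hB₁_def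
  have hB₁0 : 0 ≤ B₁ := by rw [hB₁_def]; exact Real.rpow_nonneg ha₁.le _
  -- `B₁ = δ^{-q} m'`
  have hB₁eq : B₁ = δ ^ (-q) * m' := by
    rw [hB₁_def, hm'_def, hκ₁, show δ * (2 - (2:ℝ) ^ θ) / (2 * (2:ℝ) ^ θ) = δ * m by
      rw [hm_def]; ring, Real.mul_rpow hδ.le hm0.le]
  set T : ℝ := 2 * (L + (2:ℝ) ^ θ * B₁) / κ₁ with hT
  have hT0 : 0 ≤ T := by rw [hT]; exact div_nonneg (by positivity) hκ₁0.le
  have hT' : κ₁ / 2 * T = L + (2:ℝ) ^ θ * B₁ := by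
    rw [hT]; field_simp
  have hstep1 : ∀ t : ℝ, 0 ≤ t → T ≤ t → L + (2:ℝ) ^ θ * t ^ θ ≤ κ₁ * t := by
    intro t ht hTt
    have h0 := TargetEff.rpow_le_linear_add_rpow hθ0 hθ1 ha₁ ht
    rw [← hq_def, ← hB₁_def] at h0
    have h1 := mul_le_mul_of_nonneg_left h0 h2θpos.le
    have e : (2:ℝ) ^ θ * (κ₁ / (2 * (2:ℝ) ^ θ) * t + B₁) = κ₁ / 2 * t + (2:ℝ) ^ θ * B₁ := by
      field_simp
    have h3 := mul_le_mul_of_nonneg_left hTt (by positivity : (0:ℝ) ≤ κ₁ / 2)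
    linarith
  -- `T ≤ CT δ^{-E}`
  have hTle : T ≤ CT * δ ^ (-E) := by
    have hδq1 : 1 ≤ δ ^ (-q) := TargetEff.one_le_rpow_neg hδ hδ1 hq0
    have hδq0 : 0 ≤ δ ^ (-q) := zero_le_one.trans hδq1
    have hnum : L + (2:ℝ) ^ θ * B₁ ≤ (L + (2:ℝ) ^ θ * m') * δ ^ (-q) := by
      rw [hB₁eq]
      have h1 : L ≤ L * δ ^ (-q) := le_mul_of_one_le_right hL hδq1
      have h2 : (2:ℝ) ^ θ * (δ ^ (-q) * m') = (2:ℝ) ^ θ * m' * δ ^ (-q) := by ring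
      linarith
    have hTeq : T = 2 / (2 - (2:ℝ) ^ θ) * (L + (2:ℝ) ^ θ * B₁) * δ⁻¹ := by
      rw [hT, hκ₁]; field_simp
    have hpow : δ ^ (-q) * δ⁻¹ = δ ^ (-(1 + q)) := by
      rw [← Real.rpow_neg_one, ← Real.rpow_add hδ]; ring_nf
    have hmono : δ ^ (-(1 + q)) ≤ δ ^ (-E) := TargetEff.rpow_neg_le_rpow_neg hδ hδ1 hE1q
    have hcoef : 0 ≤ 2 / (2 - (2:ℝ) ^ θ) := div_nonneg (by norm_num) hcθ.le
    calc T = 2 / (2 - (2:ℝ) ^ θ) * (L + (2:ℝ) ^ θ * B₁) * δ⁻¹ := hTeq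
      _ ≤ 2 / (2 - (2:ℝ) ^ θ) * ((L + (2:ℝ) ^ θ * m') * δ ^ (-q)) * δ⁻¹ :=
          mul_le_mul_of_nonneg_right (mul_le_mul_of_nonneg_left hnum hcoef) (inv_nonneg.mpr hδ.le)
      _ = CT * (δ ^ (-q) * δ⁻¹) := by rw [hCT_def]; ring
      _ = CT * δ ^ (-(1 + q)) := by rw [hpow]
      _ ≤ CT * δ ^ (-E) := mul_le_mul_of_nonneg_left hmono hCT0
  clear_value B₁ T
  -- Step 2: the good scale `R = ⌈exp t₀⌉`, `t₀ = max (max T (C δ^{-B})) (log R₀)`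
  set g : ℝ := C * δ ^ (-B) with hg_def
  have hg1 : 1 ≤ g := by
    have h1 : 1 ≤ δ ^ (-B) := TargetEff.one_le_rpow_neg hδ hδ1 (zero_le_one.trans hB1)
    have h2 : 1 * 1 ≤ C * δ ^ (-B) := mul_le_mul hC1 h1 zero_le_one (zero_le_one.trans hC1)
    rw [hg_def]; linarith
  have hgle : g ≤ C * δ ^ (-E) := by
    rw [hg_def]
    exact mul_le_mul_of_nonneg_left (TargetEff.rpow_neg_le_rpow_neg hδ hδ1 hEB)
      (zero_le_one.trans hC1)
  -- `δ g ≥ 1` (used for `δ t ≥ 1` below): `δ g = C δ^{1-B} ≥ 1`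
  have hδg1 : 1 ≤ δ * g := by
    have hpow : δ * δ ^ (-B) = δ ^ (-(B - 1)) := by
      rw [show -(B - 1) = 1 + -B by ring, Real.rpow_add hδ, Real.rpow_one]
    have h3 : 1 ≤ δ ^ (-(B - 1)) := TargetEff.one_le_rpow_neg hδ hδ1 (by linarith)
    have h4 : 0 ≤ δ * δ ^ (-B) := by positivity
    calc (1:ℝ) ≤ δ ^ (-(B - 1)) := h3
      _ = 1 * (δ * δ ^ (-B)) := by rw [hpow, one_mul]
      _ ≤ C * (δ * δ ^ (-B)) := mul_le_mul_of_nonneg_right hC1 h4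
      _ = δ * g := by rw [hg_def]; ring
  clear_value g
  set t₀ : ℝ := max (max T g) (Real.log R₀) with ht₀_def
  have ht₀T : T ≤ t₀ := by rw [ht₀_def]; exact (le_max_left _ _).trans (le_max_left _ _)
  have ht₀g : g ≤ t₀ := by rw [ht₀_def]; exact (le_max_right _ _).trans (le_max_left _ _)
  have ht₀R₀ : Real.log R₀ ≤ t₀ := by rw [ht₀_def]; exact le_max_right _ _
  have ht₀le' : t₀ ≤ T + g + Real.log R₀ := by
    rw [ht₀_def]
    refine max_le (max_le ?_ ?_) ?_
    · linarith
    · linarith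
    · linarith
  clear_value t₀
  have ht₀1 : 1 ≤ t₀ := hg1.trans ht₀g
  have ht₀0 : 0 ≤ t₀ := zero_le_one.trans ht₀1
  have ht₀le : t₀ ≤ C₅ * δ ^ (-E) := by
    have h2 : Real.log R₀ ≤ Real.log R₀ * δ ^ (-E) := le_mul_of_one_le_right hlogR₀ hδE1
    calc t₀ ≤ T + g + Real.log R₀ := ht₀le'
      _ ≤ CT * δ ^ (-E) + C * δ ^ (-E) + Real.log R₀ * δ ^ (-E) := by linarith
      _ = C₅ * δ ^ (-E) := by rw [hC₅_def]; ring
  set N₀ : ℕ := ⌈Real.exp t₀⌉₊ with hN₀_def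
  have hexp1 : 1 ≤ Real.exp t₀ := Real.one_le_exp ht₀0
  have hN₀exp : Real.exp t₀ ≤ (N₀ : ℝ) := by rw [hN₀_def]; exact Nat.le_ceil _
  have hN₀lt : (N₀ : ℝ) < Real.exp t₀ + 1 := by
    rw [hN₀_def]; exact Nat.ceil_lt_add_one (Real.exp_pos _).le
  clear_value N₀
  -- a `δ`-good scale `R` in the window `[N₀, N₀ ^ 2]`
  obtain ⟨R, hN₀R, hRN₀, hgoodR⟩ :
      ∃ R : ℕ, N₀ ≤ R ∧ R ≤ N₀ ^ 2 ∧
        ∀ a b c : ℕ, IsABCTriple a b c → rad a b c ≤ R → (c : ℝ) ≤ (R : ℝ) ^ (1 + δ) := by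
    refine hgood δ hδ hδ1 N₀ ?_
    calc Real.exp (C * δ ^ (-B)) = Real.exp g := by rw [hg_def]
      _ ≤ Real.exp t₀ := Real.exp_le_exp.mpr ht₀g
      _ ≤ N₀ := hN₀exp
  have hRexp : Real.exp t₀ ≤ (R : ℝ) := hN₀exp.trans (by exact_mod_cast hN₀R)
  have hRle : (R : ℝ) ≤ (2 * Real.exp t₀) ^ 2 := by
    have h1 : (R : ℝ) ≤ (N₀ : ℝ) ^ 2 := by exact_mod_cast hRN₀
    have h2 : (N₀ : ℝ) ≤ 2 * Real.exp t₀ := by linarith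
    exact h1.trans (pow_le_pow_left₀ (Nat.cast_nonneg _) h2 2)
  have hR₀R : R₀ ≤ R := by
    have h1 : (R₀ : ℝ) ≤ Real.exp t₀ := by
      have := Real.exp_le_exp.mpr ht₀R₀
      rwa [Real.exp_log (by exact_mod_cast (by omega : 0 < R₀))] at this
    exact_mod_cast h1.trans hRexp
  have hR2 : 2 ≤ R := hR₀.trans hR₀R
  have hR1 : 1 ≤ R := by omega
  have hRpos : (0:ℝ) < R := by positivity
  set t : ℝ := Real.log R with ht_def
  have htt₀ : t₀ ≤ t := by
    have := Real.log_le_log (Real.exp_pos t₀) hRexp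
    rwa [Real.log_exp, ← ht_def] at this
  have ht1 : 1 ≤ t := ht₀1.trans htt₀
  have htpos : 0 < t := by linarith
  have htle : t ≤ 4 * C₅ * δ ^ (-E) := by
    have h2 : t ≤ 2 * (Real.log 2 + t₀) := by
      have := Real.log_le_log hRpos hRle
      rwa [Real.log_pow, Real.log_mul (by norm_num) (Real.exp_pos _).ne', Real.log_exp,
        ← ht_def] at this
    have h3 : Real.log 2 < 1 := by have := Real.log_two_lt_d9; linarith
    have h4 : 1 ≤ C₅ * δ ^ (-E) := by
      have := mul_le_mul hC₅1 hδE1 zero_le_one (zero_le_one.trans hC₅1)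
      linarith
    linarith
  -- Step 3: the constants of `allScales`
  have hβ : L + (2:ℝ) ^ θ * (Real.log R) ^ θ ≤ δ * t * (2 - (2:ℝ) ^ θ) := by
    have := hstep1 t htpos.le (ht₀T.trans htt₀)
    rw [hκ₁] at this
    rw [← ht_def]; linarith
  have hβ0 : 0 ≤ δ * t := by positivity
  have htθ : 0 < t ^ θ := Real.rpow_pos_of_pos htpos θ
  set γ : ℝ := (L + t ^ θ) / (1 - (2:ℝ) ^ (-φ)) with hγ_def
  have hγpos : 0 < γ := by rw [hγ_def]; exact div_pos (by linarith) h2φ'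
  have hγ : L + (Real.log R) ^ θ ≤ γ * (1 - (2:ℝ) ^ (-φ)) := by
    rw [← ht_def, hγ_def, div_mul_cancel₀ _ (by linarith)]
  -- `γ ≤ c₃ t`
  have hγle : γ ≤ c₃ * t := by
    have h1 : t ^ θ ≤ t := by
      have := Real.rpow_le_rpow_of_exponent_le ht1 hθ1.le
      rwa [Real.rpow_one] at this
    have h3 : L ≤ L * t := le_mul_of_one_le_right hL ht1
    have h2 : L + t ^ θ ≤ (L + 1) * t := by linarith only [h1, h3]
    rw [hγ_def, hc₃_def, div_mul_eq_mul_div, div_le_div_iff_of_pos_right h2φ']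
    exact h2
  clear_value γ
  -- Step 4: the iteration
  have hall := FeketeScalesAssembly.allScales
    (fun (S : ℕ) (X : ℝ) => ∀ a b c : ℕ, IsABCTriple a b c → rad a b c ≤ S → (c : ℝ) ≤ X)
    (b := (1 + δ) * t) hθ0 hθφ hL hβ0 hγpos.le hR₀R hR1 hβ hγ
    (fun S X Y hP hXY a b c h1 h2 => (hP a b c h1 h2).trans hXY)
    (by
      intro S₁ S₂ hS₁ hS₂ X₁ X₂ hX₁ hX₂ hP₁ hP₂ a b c habc hrad
      obtain ⟨a₁, b₁, c₁, a₂, b₂, c₂, h₁, hr₁, h₂, hr₂, hc⟩ := hsub S₁ S₂ hS₁ hS₂ a b c habc hrad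
      have hc₁ : (c₁ : ℝ) ≤ X₁ := hP₁ a₁ b₁ c₁ h₁ hr₁
      have hc₂ : (c₂ : ℝ) ≤ X₂ := hP₂ a₂ b₂ c₂ h₂ hr₂
      calc (c : ℝ) ≤ Real.exp L * Real.exp (Real.log ((S₁ : ℝ) * S₂) ^ θ) * c₁ * c₂ := hc
        _ ≤ Real.exp L * Real.exp (Real.log ((S₁ : ℝ) * S₂) ^ θ) * X₁ * X₂ := by gcongr)
    (by
      intro a b c habc hrad
      have := hgoodR a b c habc hrad
      rwa [Real.rpow_def_of_pos hRpos, mul_comm, ← ht_def] at this)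
  -- Step 5: the given triple, through the least `N` with `rad ≤ R ^ N`
  set r : ℕ := rad a b c with hr_def
  have hr2 : 2 ≤ r := by rw [hr_def]; exact habc.two_le_rad
  set N : ℕ := Nat.clog R r with hN_def
  have hN1 : 1 ≤ N := by rw [hN_def]; exact Nat.clog_pos hR2 hr2
  have hrN : r ≤ R ^ N := by rw [hN_def]; exact Nat.le_pow_clog hR2 r
  have hlt : R ^ (N - 1) < r := by
    have := Nat.pow_pred_clog_lt_self hR2 (x := r) hr2
    simpa [Nat.pred_eq_sub_one, ← hN_def] using this
  clear_value N
  have hc : (c : ℝ) ≤ Real.exp (N * ((1 + δ) * t + δ * t) + γ * (N : ℝ) ^ φ) :=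
    hall N hN1 a b c habc hrN
  have hr0 : 0 < r := by omega
  have hrpos : (0:ℝ) < r := by exact_mod_cast hr0
  set x : ℝ := Real.log r with hx_def
  have hNt : (N : ℝ) * t < x + t := by
    have h1 : ((R : ℝ)) ^ (N - 1) < r := by exact_mod_cast hlt
    have h2 := Real.log_lt_log (pow_pos hRpos _) h1
    rw [Real.log_pow, Nat.cast_sub hN1] at h2
    push_cast at h2
    rw [← ht_def, ← hx_def] at h2
    linarith
  have hN0 : (0:ℝ) ≤ N := Nat.cast_nonneg N
  -- explicit sublinearity of `N ↦ γ N^φ` with slope `δ t / γ`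
  have ha₂ : 0 < δ * t / γ := by positivity
  have hsub2 : (N : ℝ) ^ φ ≤ δ * t / γ * N + (δ * t / γ) ^ (-p) := by
    have := TargetEff.rpow_le_linear_add_rpow hφ0.le hφ1 ha₂ hN0
    rwa [← hp_def] at this
  have hE2 : γ * (N : ℝ) ^ φ ≤ δ * t * N + γ * (δ * t / γ) ^ (-p) := by
    have := mul_le_mul_of_nonneg_left hsub2 hγpos.le
    have e : γ * (δ * t / γ * N + (δ * t / γ) ^ (-p)) = δ * t * N + γ * (δ * t / γ) ^ (-p) := by
      field_simp
    linarith
  have hE1 : (N : ℝ) * ((1 + δ) * t + δ * t) ≤ (1 + 2 * δ) * (x + t) := by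
    have := mul_le_mul_of_nonneg_left hNt.le (by positivity : (0:ℝ) ≤ 1 + 2 * δ)
    linarith
  have hE3 : δ * t * N ≤ δ * (x + t) := by
    have := mul_le_mul_of_nonneg_left hNt.le hδ.le
    linarith
  -- Step 6: the intercept `(1+3δ) t + γ (δ t/γ)^{-p} ≤ 5 (c₃ t)^{1+p} ≤ A δ^{-k}`
  have hδt1 : 1 ≤ δ * t := by
    have h1 : δ * g ≤ δ * t := mul_le_mul_of_nonneg_left (ht₀g.trans htt₀) hδ.le
    exact hδg1.trans h1
  have hct : 0 < c₃ * t := mul_pos hc₃0 htpos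
  have hinter : γ * (δ * t / γ) ^ (-p) ≤ (c₃ * t) ^ (1 + p) := by
    have hq1 : (δ * t / γ) ^ (-p) = (γ / (δ * t)) ^ p := by
      rw [Real.rpow_neg ha₂.le, ← Real.inv_rpow ha₂.le, inv_div]
    have hq2 : γ / (δ * t) ≤ γ := div_le_self hγpos.le hδt1
    have hq3 : (γ / (δ * t)) ^ p ≤ γ ^ p := Real.rpow_le_rpow (by positivity) hq2 hp0
    have hq4 : γ ^ p ≤ (c₃ * t) ^ p := Real.rpow_le_rpow hγpos.le hγle hp0
    rw [hq1, Real.rpow_add hct, Real.rpow_one]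
    calc γ * (γ / (δ * t)) ^ p ≤ γ * γ ^ p := mul_le_mul_of_nonneg_left hq3 hγpos.le
      _ ≤ (c₃ * t) * (c₃ * t) ^ p :=
          mul_le_mul hγle hq4 (Real.rpow_nonneg hγpos.le _) hct.le
  have hlin : (1 + 3 * δ) * t ≤ 4 * (c₃ * t) ^ (1 + p) := by
    have hct1 : 1 ≤ c₃ * t := by
      have := mul_le_mul hc₃1 ht1 zero_le_one (zero_le_one.trans hc₃1)
      linarith
    have h1 : c₃ * t ≤ (c₃ * t) ^ (1 + p) := by
      have := Real.rpow_le_rpow_of_exponent_le hct1 (by linarith : (1:ℝ) ≤ 1 + p)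
      rwa [Real.rpow_one] at this
    have h2 : t ≤ c₃ * t := by
      have := mul_le_mul_of_nonneg_right hc₃1 htpos.le
      linarith
    have h3 : (1 + 3 * δ) * t ≤ 4 * t := by
      have := mul_le_mul_of_nonneg_right (by linarith : 1 + 3 * δ ≤ 4) htpos.le
      linarith
    linarith
  have hpow5 : (c₃ * t) ^ (1 + p) ≤ (4 * c₃ * C₅) ^ (1 + p) * δ ^ (-(E * (1 + p))) := by
    have h1 : c₃ * t ≤ (4 * c₃ * C₅) * δ ^ (-E) := by
      have := mul_le_mul_of_nonneg_left htle hc₃0.le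
      linarith
    have h2 : (c₃ * t) ^ (1 + p) ≤ ((4 * c₃ * C₅) * δ ^ (-E)) ^ (1 + p) :=
      Real.rpow_le_rpow hct.le h1 (by linarith)
    have h3 : ((4 * c₃ * C₅) * δ ^ (-E)) ^ (1 + p)
        = (4 * c₃ * C₅) ^ (1 + p) * δ ^ (-(E * (1 + p))) := by
      rw [Real.mul_rpow (by positivity) hδE0.le, ← Real.rpow_mul hδ.le]
      congr 2; ring
    rw [h3] at h2
    exact h2
  -- Step 7: assemble
  have hcpos : (0:ℝ) < c := by
    obtain ⟨ha, hb, habc', -⟩ := habc; exact_mod_cast (show 0 < c by omega)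
  have hlogc : Real.log (c : ℝ) ≤ N * ((1 + δ) * t + δ * t) + γ * (N : ℝ) ^ φ := by
    have := Real.log_le_log hcpos hc
    rwa [Real.log_exp] at this
  have hA0 : 0 ≤ (4 * c₃ * C₅) ^ (1 + p) := Real.rpow_nonneg (by positivity) _
  have hfin : (1 + 3 * δ) * t + γ * (δ * t / γ) ^ (-p)
      ≤ 5 * (4 * c₃ * C₅) ^ (1 + p) * δ ^ (-(E * (1 + p))) := by
    have := mul_le_mul_of_nonneg_left hpow5 (by norm_num : (0:ℝ) ≤ 5)
    linarith
  calc Real.log (c : ℝ) ≤ N * ((1 + δ) * t + δ * t) + γ * (N : ℝ) ^ φ := hlogc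
    _ ≤ (1 + 2 * δ) * (x + t) + δ * (x + t) + γ * (δ * t / γ) ^ (-p) := by linarith
    _ = (1 + 3 * δ) * x + ((1 + 3 * δ) * t + γ * (δ * t / γ) ^ (-p)) := by ring
    _ ≤ (1 + 3 * δ) * x + 5 * (4 * c₃ * C₅) ^ (1 + p) * δ ^ (-(E * (1 + p))) := by linarith
    _ = (1 + 3 * δ) * Real.log ((rad a b c : ℕ) : ℝ)
          + 5 * (4 * c₃ * C₅) ^ (1 + p) * δ ^ (-(E * (1 + p))) := by rw [hx_def, hr_def]

/-- Closed form of `TargetEff.logBound_core` (all data universally quantified), the registered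
calibration sub-goal of line `SketchIdeator2` for this file (stated fully qualified, on one line).
[folklore] -/
theorem calib_logBound_of_submult_of_effectiveGoodScales : ∀ θ L B C : ℝ, ∀ R₀ : ℕ, 0 ≤ θ → θ < 1 → 0 ≤ L → 1 ≤ B → 1 ≤ C → 2 ≤ R₀ → (∀ R₁ R₂ : ℕ, R₀ ≤ R₁ → R₀ ≤ R₂ → ∀ a b c : ℕ, Literature.NumberTheory.DiophantineGeometry.IsABCTriple a b c → Literature.NumberTheory.DiophantineGeometry.rad a b c ≤ R₁ * R₂ → ∃ a₁ b₁ c₁ a₂ b₂ c₂ : ℕ, Literature.NumberTheory.DiophantineGeometry.IsABCTriple a₁ b₁ c₁ ∧ Literature.NumberTheory.DiophantineGeometry.rad a₁ b₁ c₁ ≤ R₁ ∧ Literature.NumberTheory.DiophantineGeometry.IsABCTriple a₂ b₂ c₂ ∧ Literature.NumberTheory.DiophantineGeometry.rad a₂ b₂ c₂ ≤ R₂ ∧ (c : ℝ) ≤ Real.exp L * Real.exp (Real.log ((R₁ : ℝ) * R₂) ^ θ) * c₁ * c₂) → (∀ δ : ℝ, 0 < δ → δ ≤ 1 → ∀ R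 : ℕ, Real.exp (C * δ ^ (-B)) ≤ (R : ℝ) → ∀ a b c : ℕ, Literature.NumberTheory.DiophantineGeometry.IsABCTriple a b c → Literature.NumberTheory.DiophantineGeometry.rad a b c ≤ R → (c : ℝ) ≤ (R : ℝ) ^ (1 + δ)) → ∃ k A : ℝ, 0 ≤ k ∧ ∀ δ : ℝ, 0 < δ → δ ≤ 1 → ∀ a b c : ℕ, Literature.NumberTheory.DiophantineGeometry.IsABCTriple a b c → Real.log (c : ℝ) ≤ (1 + 3 * δ) * Real.log ((Literature.NumberTheory.DiophantineGeometry.rad a b c : ℕ) : ℝ) + A * δ ^ (-k) :=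
  fun _θ _L _B _C _R₀ hθ0 hθ1 hL hB1 hC1 hR₀ hsub hgood =>
    TargetEff.logBound_core hθ0 hθ1 hL hB1 hC1 hR₀ hsub
      (fun δ hδ hδ1 N hN => ⟨N, le_rfl, Nat.le_self_pow two_ne_zero N, hgood δ hδ hδ1 N hN⟩)

end Summit.ABC.ABC.Theorems
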